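import Summits.HubbardSuperconductivity.HubbardSuperconductivity.Theorems.BalabanIRBirComplexStableXYRRotorWitness
import Literature.Probability.LatticeModels.GinibreInequality
import HarnessLib

/-!
# RP-free long-range order of the `(2+1)`-dimensional XY rotor on `(ℤ/L)² × ℤ/M`:
# IV. The real ferromagnetic cone of finite-range tables (Ginibre)

Fourth file of the BC5 witness for `BirComplexStableXYR` (stmt-HubbardSuperconductivity-14845,
route `BalabanIR`).  The crux quantifies over finite-range window tables on `W_r = (Fin r)³`
acting through the shifts `sh_s w = (s.1 + (w₁, w₂), s.2 + w₃)` of `Λ = (ℤ/L)² × ℤ/M`.  File III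
proved the parity-free, RP-free slice order for the nearest-neighbour XY table.  Here the rung is
widened to the whole REAL FERROMAGNETIC CONE (the "ginibre-ferromagnetic-cone" face named in the
crux's informal statement): every real table

  `F_J(φ) = ∑_{w,w'} J_{w w'} (1 − cos(φ_w − φ_{w'}))`,  `J ≥ 0`,

whose couplings on the three nearest-neighbour window pairs `((0,0,0),(1,0,0))`,
`((0,0,0),(0,1,0))`, `((0,0,0),(0,0,1))` are `≥ 1`, has, for the SAME `K₀, L₀` as the XY table
(independent of `r` and `J`), `Z > 0` and slice order `≥ 1/2` for all `K ≥ K₀`, `L₀ ≤ L ≤ M`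
(`birSliceFerroConeOrder_rpFree`).  Proof: J. Ginibre's inequality (Comm. Math. Phys. 16 (1970),
the tree's `ginibreExpect_reChar_mono`): on the torus `U(1)^Λ` the two-point function
`⟨cos(θ_a − θ_b)⟩` is non-decreasing in every non-negative coupling of a Hamiltonian
`∑ J_A cos(m_A·θ)`; the table's Gibbs weight is the Ginibre weight with couplings `K J_{ww'}` on
the characters `θ̄_{sh_s w} θ_{sh_s w'}`, which dominate the couplings `K·1_{nn}` reproducing the
XY weight of the space-time bond system; then file II (`xyRotor_slice_twoPoint_ge_half`) and the
angle-cube dictionary of file III.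

## References
* J. Ginibre, Comm. Math. Phys. 16 (1970) 310–328 (plane-rotator example). [Ginibre1970]
* C. Garban, T. Spencer, arXiv:2109.01617, Thm. 1.3, Remarks 1 and 14. [GarbanSpencer2022]
-/

noncomputable section

set_option linter.dupNamespace false -- summit = problem name (single-conjunct summit), D-0017

namespace Summit.HubbardSuperconductivity.HubbardSuperconductivity.Theorems

open MeasureTheory Finset Set
open scoped BigOperators ComplexConjugate
open Literature.Probability.LatticeModels

/-! ### The XY energy of the space-time bond system, site by site -/

/-- `cosDiff` is symmetric. [folklore] -/
theorem cosDiff_comm {V : Type*} (x y : V) (θ : V → Circle) : cosDiff x y θ = cosDiff y x θ := by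
  rw [cosDiff_eq_reChar, cosDiff_eq_reChar, reChar_diffChar_comm]

/-- **The XY energy of `(ℤ/L)² × ℤ/M` site by site**:
`∑_{(s,μ)} Re(θ̄_s θ_{s+e_μ}) = ∑_s [cosDiff s (s+e₁) + cosDiff s (s+e₂) + cosDiff s (s+e_τ)]`.
[folklore] -/
theorem xyEnergy_eq_sum_sites (L M : ℕ) [NeZero L] [NeZero M] (φ : JCurrent.SpaceTimeSite 2 L M → Circle) :
    (JCurrent.bondSystem 2 L M).energy 1 φ =
      ∑ s : JCurrent.SpaceTimeSite 2 L M,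
        (cosDiff s ((s.1 + ![1, 0], s.2) : JCurrent.SpaceTimeSite 2 L M) φ +
          cosDiff s ((s.1 + ![0, 1], s.2) : JCurrent.SpaceTimeSite 2 L M) φ +
          cosDiff s ((s.1, s.2 + 1) : JCurrent.SpaceTimeSite 2 L M) φ) := by
  rw [BondSystem.energy]
  have hbond : ∀ a : JCurrent.Bond 2 L M,
      (((JCurrent.bondSystem 2 L M).bondVar 1 φ a : Circle) : ℂ).re =
        cosDiff a.1 (a.1 + JCurrent.unitVec a.2) φ := by
    intro a
    rw [BondSystem.coe_bondVar, Pi.one_apply, Circle.coe_one, one_mul, cosDiff]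
    rfl
  simp_rw [hbond]
  rw [Fintype.sum_prod_type]
  refine Finset.sum_congr rfl fun s _ => ?_
  rw [Fintype.sum_option, Fin.sum_univ_two]
  obtain ⟨h0, h1⟩ := pi_single_fin_two L
  simp only [JCurrent.unitVec, h0, h1]
  have e1 : s + ((0 : TorusSite 2 L), (1 : ZMod M)) = (s.1, s.2 + 1) := by ext <;> simp
  have e2 : s + ((![1, 0] : TorusSite 2 L), (0 : ZMod M)) = (s.1 + ![1, 0], s.2) := by ext <;> simp
  have e3 : s + ((![0, 1] : TorusSite 2 L), (0 : ZMod M)) = (s.1 + ![0, 1], s.2) := by ext <;> simp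
  rw [e1, e2, e3]
  ring

/-! ### Linearity of Ginibre expectations -/

/-- A Ginibre expectation of `c · ∑∑ f` is `c · ∑∑` of the expectations (continuous observables on
a compact group). [folklore] -/
theorem ginibreExpect_const_mul_sum_sum {Ω : Type*} [CommGroup Ω] [TopologicalSpace Ω]
    [CompactSpace Ω] [MeasurableSpace Ω] [OpensMeasurableSpace Ω] (μ : Measure Ω) [IsFiniteMeasure μ]
    {ι : Type*} [Fintype ι] (χ : ι → Ω →ₜ* Circle) (J : ι → ℝ) {S : Type*} [Fintype S]
    (c : ℝ) (f : S → S → Ω → ℝ) (hf : ∀ x y, Continuous (f x y)) :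
    ginibreExpect μ χ J (fun θ => c * ∑ x, ∑ y, f x y θ) =
      c * ∑ x, ∑ y, ginibreExpect μ χ J (f x y) := by
  unfold ginibreExpect
  have hw := continuous_ginibreWeight χ J
  have hint : ∀ x y, Integrable (fun θ => f x y θ * ginibreWeight χ J θ) μ := fun x y =>
    integrable_of_continuous_compactSpace μ ((hf x y).mul hw)
  have e : (fun θ => (c * ∑ x, ∑ y, f x y θ) * ginibreWeight χ J θ) =
      fun θ => c * ∑ x, ∑ y, f x y θ * ginibreWeight χ J θ := by
    funext θ; rw [mul_assoc, Finset.sum_mul]; congr 1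
    exact Finset.sum_congr rfl fun x _ => Finset.sum_mul _ _ _
  rw [e, integral_const_mul, integral_finsetSum _ (fun x _ => integrable_finsetSum _ fun y _ => hint x y)]
  rw [mul_div_assoc, Finset.sum_div]
  congr 1
  refine Finset.sum_congr rfl fun x _ => ?_
  rw [integral_finsetSum _ (fun y _ => hint x y), Finset.sum_div]

/-! ### The rung for the real ferromagnetic cone -/

/-- **BC5 WITNESS, widened to the real ferromagnetic cone (Ginibre).**  There are `K₀, L₀`
(those of the XY table, independent of the window size and of the table) such that for every
`r ≥ 2`, every real non-negative table `J` on `W_r × W_r` (`W_r = (Fin r)³`) whose couplings on the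
three nearest-neighbour window pairs `((0,0,0),(1,0,0))`, `((0,0,0),(0,1,0))`, `((0,0,0),(0,0,1))`
are `≥ 1`, every `K ≥ K₀` and all `L₀ ≤ L ≤ M`: the finite-range ferromagnetic plane rotator
`exp(−K ∑_s F_J(θ ∘ sh_s)) dθ` on `[0,2π]^Λ`, `Λ = (ℤ/L)² × ℤ/M`,
`F_J(φ) = ∑_{w,w'} J_{ww'}(1 − cos(φ_w − φ_{w'}))`, `sh_s w = (s.1 + (w₁,w₂), s.2 + w₃)` (the crux's
shifts), has `Z > 0` and slice order `⟨|L⁻² ∑_x e^{iθ(x,0)}|²⟩ ≥ 1/2` — no parity hypothesis, no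
reflection positivity (Ginibre monotonicity in the couplings on top of the Garban–Spencer rung
`xyRotor_slice_twoPoint_ge_half`). [cite: Ginibre1970, main theorem with the plane-rotator example cos(m·φ)] -/
theorem birSliceFerroConeOrder_rpFree :
    ∃ K₀ : ℝ, ∃ L₀ : ℕ, ∀ (r : ℕ) (hr : 1 < r) (J : (Fin r × Fin r × Fin r) → (Fin r × Fin r × Fin r) → ℝ), (∀ w w', 0 ≤ J w w') → 1 ≤ J (⟨0, Nat.zero_lt_of_lt hr⟩, ⟨0, Nat.zero_lt_of_lt hr⟩, ⟨0, Nat.zero_lt_of_lt hr⟩) (⟨1, hr⟩, ⟨0, Nat.zero_lt_of_lt hr⟩, ⟨0, Nat.zero_lt_of_lt hr⟩) → 1 ≤ J (⟨0, Nat.zero_lt_of_lt hr⟩, ⟨0, Nat.zero_lt_of_lt hr⟩, ⟨0, Nat.zero_lt_of_lt hr⟩) (⟨0, Nat.zero_lt_of_lt hr⟩, ⟨1, hr⟩, ⟨0, Nat.zero_lt_of_lt hr⟩) → 1 ≤ J (⟨0, Nat.zero_lt_of_lt hr⟩, ⟨0, Nat.zero_lt_of_lt hr⟩, ⟨0, Nat.zero_lt_of_lt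 hr⟩) (⟨0, Nat.zero_lt_of_lt hr⟩, ⟨0, Nat.zero_lt_of_lt hr⟩, ⟨1, hr⟩) → ∀ K : ℝ, K₀ ≤ K → ∀ (L M : ℕ) [NeZero L] [NeZero M], L₀ ≤ L → L ≤ M → let sh : (Literature.Probability.LatticeModels.TorusSite 2 L × ZMod M) → (Fin r × Fin r × Fin r) → (Literature.Probability.LatticeModels.TorusSite 2 L × ZMod M) := fun s w => (s.1 + ![((w.1 : ℕ) : ZMod L), ((w.2.1 : ℕ) : ZMod L)], s.2 + ((w.2.2 : ℕ) : ZMod M)); let F : ((Fin r × Fin r × Fin r) → ℝ) → ℝ := fun φ => ∑ w, ∑ w', J w w' * (1 - Real.cos (φ w - φ w')); let A : ((Literature.Probability.LatticeModels.TorusSite 2 L × ZMod M) → ℝ) → ℝ := fun θ => K * ∑ s : (Literature.Probability.LatticeModels.TorusSite 2 L × ZMod M), F (fun w => θ (sh s w)); let cube : Set ((Literature.Probability.LatticeModels.TorusSite 2 L × ZMod M) → ℝ) := Set.pi Set.univ (fun _ => Set.Icc (0:ℝ) (2 * Real.pi)); let Z : ℝ := MeasureTheory.integral (MeasureTheory.volume.restrict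 cube) (fun θ => Real.exp (-(A θ))); let O : ((Literature.Probability.LatticeModels.TorusSite 2 L × ZMod M) → ℝ) → ℝ := fun θ => ‖∑ x : Literature.Probability.LatticeModels.TorusSite 2 L, Complex.exp (Complex.I * (θ (x, 0) : ℂ))‖ ^ 2 / (L : ℝ) ^ 4; 0 < Z ∧ (1/2 : ℝ) ≤ MeasureTheory.integral (MeasureTheory.volume.restrict cube) (fun θ => O θ * Real.exp (-(A θ))) / Z := by
  obtain ⟨K₂, hK₂, hall⟩ := xyRotor_slice_twoPoint_ge_half
  refine ⟨K₂, 40, ?_⟩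
  intro r hr J hJnn hJ1 hJ2 hJ3 K hK L M _ _ hL hLM
  dsimp only
  have hK0 : 0 ≤ K := le_trans hK₂.le hK
  -- abbreviations
  set o : Fin r := ⟨0, Nat.zero_lt_of_lt hr⟩ with ho
  set i : Fin r := ⟨1, hr⟩ with hi
  have hio : i ≠ o := by simp [hi, ho, Fin.ext_iff]
  set sh : JCurrent.SpaceTimeSite 2 L M → (Fin r × Fin r × Fin r) → JCurrent.SpaceTimeSite 2 L M := fun s w =>
    (s.1 + ![((w.1 : ℕ) : ZMod L), ((w.2.1 : ℕ) : ZMod L)], s.2 + ((w.2.2 : ℕ) : ZMod M)) with hsh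
  set G := JCurrent.bondSystem 2 L M with hG
  -- the Ginibre rendering: characters `θ̄_{sh s w} θ_{sh s w'}`, couplings `K J_{ww'}`
  set χ : JCurrent.SpaceTimeSite 2 L M × ((Fin r × Fin r × Fin r) × (Fin r × Fin r × Fin r)) →
      (JCurrent.SpaceTimeSite 2 L M → Circle) →ₜ* Circle := fun a => diffChar (sh a.1 a.2.1) (sh a.1 a.2.2) with hχ
  set Jhi : JCurrent.SpaceTimeSite 2 L M × ((Fin r × Fin r × Fin r) × (Fin r × Fin r × Fin r)) → ℝ :=
    fun a => K * J a.2.1 a.2.2 with hJhi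
  -- the three nearest-neighbour window pairs and the reference (XY) couplings
  set P1 : (Fin r × Fin r × Fin r) × (Fin r × Fin r × Fin r) := ((o, o, o), (i, o, o)) with hP1
  set P2 : (Fin r × Fin r × Fin r) × (Fin r × Fin r × Fin r) := ((o, o, o), (o, i, o)) with hP2
  set P3 : (Fin r × Fin r × Fin r) × (Fin r × Fin r × Fin r) := ((o, o, o), (o, o, i)) with hP3
  have hP12 : P1 ≠ P2 := by simp [hP1, hP2, hio]
  have hP13 : P1 ≠ P3 := by simp [hP1, hP3, hio]
  have hP23 : P2 ≠ P3 := by simp [hP2, hP3, hio]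
  set J0 : (Fin r × Fin r × Fin r) × (Fin r × Fin r × Fin r) → ℝ := fun p =>
    (if p = P1 then 1 else 0) + (if p = P2 then 1 else 0) + (if p = P3 then 1 else 0) with hJ0def
  set Jlo : JCurrent.SpaceTimeSite 2 L M × ((Fin r × Fin r × Fin r) × (Fin r × Fin r × Fin r)) → ℝ :=
    fun a => K * J0 a.2 with hJlo
  -- `0 ≤ Jlo ≤ Jhi`
  have hJ0nn : ∀ p, 0 ≤ J0 p := by
    intro p; simp only [hJ0def]
    refine add_nonneg (add_nonneg ?_ ?_) ?_ <;> split_ifs <;> norm_num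
  have hJlo0 : ∀ a, 0 ≤ Jlo a := fun a => by simp only [hJlo]; exact mul_nonneg hK0 (hJ0nn a.2)
  have hJ0le : ∀ p : (Fin r × Fin r × Fin r) × (Fin r × Fin r × Fin r), J0 p ≤ J p.1 p.2 := by
    intro p
    simp only [hJ0def]
    by_cases h1 : p = P1
    · rw [if_pos h1, if_neg (fun e => hP12 (h1.symm.trans e)), if_neg (fun e => hP13 (h1.symm.trans e))]
      rw [h1, hP1]; linarith [hJ1]
    by_cases h2 : p = P2
    · rw [if_neg h1, if_pos h2, if_neg (fun e => hP23 (h2.symm.trans e))]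
      rw [h2, hP2]; linarith [hJ2]
    by_cases h3 : p = P3
    · rw [if_neg h1, if_neg h2, if_pos h3]
      rw [h3, hP3]; linarith [hJ3]
    rw [if_neg h1, if_neg h2, if_neg h3]
    linarith [hJnn p.1 p.2]
  have hJle : ∀ a, Jlo a ≤ Jhi a := fun a => by
    simp only [hJlo, hJhi]; exact mul_le_mul_of_nonneg_left (hJ0le a.2) hK0
  -- the three nearest-neighbour shifts
  have hsh0 : ∀ s : JCurrent.SpaceTimeSite 2 L M, sh s (o, o, o) = s := by
    intro s; refine Prod.ext ?_ ?_
    · funext j; fin_cases j <;> simp [hsh, ho, Matrix.vecHead, Matrix.vecTail]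
    · simp [hsh, ho]
  have hsh1 : ∀ s : JCurrent.SpaceTimeSite 2 L M, sh s (i, o, o) = (s.1 + ![1, 0], s.2) := by
    intro s; refine Prod.ext ?_ ?_
    · funext j; fin_cases j <;> simp [hsh, ho, hi, Matrix.vecHead, Matrix.vecTail]
    · simp [hsh, ho]
  have hsh2 : ∀ s : JCurrent.SpaceTimeSite 2 L M, sh s (o, i, o) = (s.1 + ![0, 1], s.2) := by
    intro s; refine Prod.ext ?_ ?_
    · funext j; fin_cases j <;> simp [hsh, ho, hi, Matrix.vecHead, Matrix.vecTail]
    · simp [hsh, ho]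
  have hsh3 : ∀ s : JCurrent.SpaceTimeSite 2 L M, sh s (o, o, i) = (s.1, s.2 + 1) := by
    intro s; refine Prod.ext ?_ ?_
    · funext j; fin_cases j <;> simp [hsh, ho, Matrix.vecHead, Matrix.vecTail]
    · simp [hsh, ho, hi]
  -- single-indicator sums
  have hS : ∀ (P : (Fin r × Fin r × Fin r) × (Fin r × Fin r × Fin r))
      (g : (Fin r × Fin r × Fin r) × (Fin r × Fin r × Fin r) → ℝ),
      ∑ p, (if p = P then (1 : ℝ) else 0) * g p = g P := by
    intro P g
    simp only [ite_mul, one_mul, zero_mul, Finset.sum_ite_eq', Finset.mem_univ, if_true]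
  -- the small Ginibre weight IS the XY weight
  have hlo_weight : ∀ φ : JCurrent.SpaceTimeSite 2 L M → Circle, ginibreWeight χ Jlo φ = G.weight K 1 φ := by
    intro φ
    rw [ginibreWeight, BondSystem.weight, hG, xyEnergy_eq_sum_sites, ginibreHamiltonian, Fintype.sum_prod_type,
      Finset.mul_sum]
    congr 1
    refine Finset.sum_congr rfl fun s _ => ?_
    have hterm : ∀ p : (Fin r × Fin r × Fin r) × (Fin r × Fin r × Fin r),
        Jlo (s, p) * reChar (χ (s, p)) φ =
          K * ((if p = P1 then (1 : ℝ) else 0) * reChar (χ (s, p)) φ) +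
            K * ((if p = P2 then (1 : ℝ) else 0) * reChar (χ (s, p)) φ) +
            K * ((if p = P3 then (1 : ℝ) else 0) * reChar (χ (s, p)) φ) := by
      intro p; simp only [hJlo, hJ0def]; ring
    rw [Finset.sum_congr rfl fun p _ => hterm p, Finset.sum_add_distrib, Finset.sum_add_distrib,
      ← Finset.mul_sum, ← Finset.mul_sum, ← Finset.mul_sum,
      hS P1 (fun p => reChar (χ (s, p)) φ), hS P2 (fun p => reChar (χ (s, p)) φ),
      hS P3 (fun p => reChar (χ (s, p)) φ)]
    simp only [hχ, hP1, hP2, hP3, ← cosDiff_eq_reChar, hsh0, hsh1, hsh2, hsh3]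
    ring
  -- the small Ginibre expectation IS the XY expectation
  have hlo_expect : ∀ f : (JCurrent.SpaceTimeSite 2 L M → Circle) → ℝ,
      ginibreExpect (torusHaar (JCurrent.SpaceTimeSite 2 L M)) χ Jlo f = G.expect K 1 f := by
    intro f
    rw [ginibreExpect, BondSystem.expect, BondSystem.partitionFn]
    simp only [hlo_weight]
  -- Ginibre: every two-point function of the table dominates the XY one, hence `≥ 1/2`
  have hpair : ∀ x y : TorusSite 2 L,
      (1 / 2 : ℝ) ≤ ginibreExpect (torusHaar (JCurrent.SpaceTimeSite 2 L M)) χ Jhi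
        (cosDiff ((x, 0) : JCurrent.SpaceTimeSite 2 L M) ((y, 0))) := by
    intro x y
    have hmono := ginibreExpect_reChar_mono (torusHaar (JCurrent.SpaceTimeSite 2 L M)) surjective_mul_self_torus χ
      (diffChar ((x, 0) : JCurrent.SpaceTimeSite 2 L M) ((y, 0))) hJlo0 hJle
    have e : (cosDiff ((x, 0) : JCurrent.SpaceTimeSite 2 L M) ((y, 0)) : (JCurrent.SpaceTimeSite 2 L M → Circle) → ℝ) =
        reChar (diffChar ((x, 0) : JCurrent.SpaceTimeSite 2 L M) ((y, 0))) :=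
      funext fun θ => cosDiff_eq_reChar _ _ θ
    rw [e]
    refine le_trans ?_ hmono
    rw [← e, hlo_expect]
    exact hall K hK L M hL hLM x y
  -- the cube integrals are Ginibre integrals at `e^{iθ}`
  set c₀ : ℝ := K * ∑ _s : JCurrent.SpaceTimeSite 2 L M, ∑ w : Fin r × Fin r × Fin r, ∑ w' : Fin r × Fin r × Fin r, J w w'
    with hc₀
  have hA : ∀ θ : JCurrent.SpaceTimeSite 2 L M → ℝ,
      Real.exp (-(K * ∑ s : JCurrent.SpaceTimeSite 2 L M, ∑ w : Fin r × Fin r × Fin r, ∑ w' : Fin r × Fin r × Fin r,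
        J w w' * (1 - Real.cos (θ (sh s w) - θ (sh s w'))))) =
        Real.exp (-c₀) * ginibreWeight χ Jhi (fun v => Circle.exp (θ v)) := by
    intro θ
    rw [ginibreWeight, ← Real.exp_add]
    congr 1
    rw [ginibreHamiltonian, Fintype.sum_prod_type, hc₀]
    have ec : ∀ (s : JCurrent.SpaceTimeSite 2 L M) (p : (Fin r × Fin r × Fin r) × (Fin r × Fin r × Fin r)),
        Jhi (s, p) * reChar (χ (s, p)) (fun v => Circle.exp (θ v)) =
          K * (J p.1 p.2 * Real.cos (θ (sh s p.1) - θ (sh s p.2))) := by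
      intro s p
      simp only [hJhi, hχ, reChar_diffChar_exp]
      rw [← Real.cos_neg, neg_sub]; ring
    simp only [ec, ← Finset.mul_sum, Fintype.sum_prod_type, mul_sub, mul_one, Finset.sum_sub_distrib]
    ring
  set Oc : (JCurrent.SpaceTimeSite 2 L M → Circle) → ℝ := fun φ =>
    (∑ x : TorusSite 2 L, ∑ y : TorusSite 2 L, cosDiff ((x, 0) : JCurrent.SpaceTimeSite 2 L M) ((y, 0)) φ) / (L : ℝ) ^ 4
    with hOc
  have hOcc : Continuous Oc := by
    rw [hOc]
    exact (continuous_finsetSum _ fun x _ => continuous_finsetSum _ fun y _ =>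
      continuous_cosDiff _ _).div_const _
  have hwc : Continuous (ginibreWeight χ Jhi) := continuous_ginibreWeight χ Jhi
  have h1 := setIntegral_angleCube_comp_exp (V := JCurrent.SpaceTimeSite 2 L M) (fun φ => Oc φ * ginibreWeight χ Jhi φ)
    (hOcc.mul hwc).aestronglyMeasurable
  have h2 := setIntegral_angleCube_comp_exp (V := JCurrent.SpaceTimeSite 2 L M) (ginibreWeight χ Jhi)
    hwc.aestronglyMeasurable
  simp only [smul_eq_mul] at h1 h2
  have key1 : (fun θ : JCurrent.SpaceTimeSite 2 L M → ℝ =>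
      ‖∑ x : TorusSite 2 L, Complex.exp (Complex.I * (θ (x, 0) : ℂ))‖ ^ 2 / (L : ℝ) ^ 4 *
        Real.exp (-(K * ∑ s : JCurrent.SpaceTimeSite 2 L M, ∑ w : Fin r × Fin r × Fin r, ∑ w' : Fin r × Fin r × Fin r,
          J w w' * (1 - Real.cos (θ (sh s w) - θ (sh s w')))))) =
      fun θ => Real.exp (-c₀) * (Oc (fun v => Circle.exp (θ v)) * ginibreWeight χ Jhi (fun v => Circle.exp (θ v))) := by
    funext θ; rw [hA, hOc, sliceOrder_eq_sum_cosDiff L M θ]; ring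
  have key2 : (fun θ : JCurrent.SpaceTimeSite 2 L M → ℝ =>
      Real.exp (-(K * ∑ s : JCurrent.SpaceTimeSite 2 L M, ∑ w : Fin r × Fin r × Fin r, ∑ w' : Fin r × Fin r × Fin r,
        J w w' * (1 - Real.cos (θ (sh s w) - θ (sh s w')))))) =
      fun θ => Real.exp (-c₀) * ginibreWeight χ Jhi (fun v => Circle.exp (θ v)) := by
    funext θ; rw [hA]
  have hZpos : 0 < ∫ u, ginibreWeight χ Jhi u ∂torusHaar (JCurrent.SpaceTimeSite 2 L M) :=
    integral_exp_pos (integrable_of_continuous_compactSpace _ hwc)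
  rw [key1, key2, integral_const_mul, integral_const_mul, h1, h2]
  refine ⟨by positivity, ?_⟩
  rw [mul_div_mul_left _ _ (ne_of_gt (Real.exp_pos _)), mul_div_mul_left _ _ (by positivity)]
  -- now a Ginibre expectation of `Oc`
  have hexp : (∫ u, Oc u * ginibreWeight χ Jhi u ∂torusHaar (JCurrent.SpaceTimeSite 2 L M)) /
      (∫ u, ginibreWeight χ Jhi u ∂torusHaar (JCurrent.SpaceTimeSite 2 L M)) =
      ginibreExpect (torusHaar (JCurrent.SpaceTimeSite 2 L M)) χ Jhi Oc := rfl
  rw [hexp]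
  have hlin : ginibreExpect (torusHaar (JCurrent.SpaceTimeSite 2 L M)) χ Jhi Oc = ((L : ℝ) ^ 4)⁻¹ *
      ∑ x : TorusSite 2 L, ∑ y : TorusSite 2 L, ginibreExpect (torusHaar (JCurrent.SpaceTimeSite 2 L M)) χ Jhi
        (cosDiff ((x, 0) : JCurrent.SpaceTimeSite 2 L M) ((y, 0))) := by
    have e : Oc = fun φ => ((L : ℝ) ^ 4)⁻¹ *
        ∑ x : TorusSite 2 L, ∑ y : TorusSite 2 L, cosDiff ((x, 0) : JCurrent.SpaceTimeSite 2 L M) ((y, 0)) φ := by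
      funext φ; simp only [hOc]; rw [div_eq_inv_mul]
    rw [e]
    exact ginibreExpect_const_mul_sum_sum (torusHaar (JCurrent.SpaceTimeSite 2 L M)) χ Jhi _
      (fun x y => cosDiff ((x, 0) : JCurrent.SpaceTimeSite 2 L M) ((y, 0))) (fun x y => continuous_cosDiff _ _)
  rw [hlin]
  have hcard : (Fintype.card (TorusSite 2 L) : ℝ) = (L : ℝ) ^ 2 := by
    rw [Fintype.card_fun, ZMod.card, Fintype.card_fin]; push_cast; ring
  have hL0 : (0 : ℝ) < L := by exact_mod_cast Nat.pos_of_ne_zero (NeZero.ne L)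
  have hsum : (1 / 2 : ℝ) * (L : ℝ) ^ 4 ≤ ∑ x : TorusSite 2 L, ∑ y : TorusSite 2 L,
      ginibreExpect (torusHaar (JCurrent.SpaceTimeSite 2 L M)) χ Jhi
        (cosDiff ((x, 0) : JCurrent.SpaceTimeSite 2 L M) ((y, 0))) := by
    calc (1 / 2 : ℝ) * (L : ℝ) ^ 4 = ∑ _x : TorusSite 2 L, ∑ _y : TorusSite 2 L, (1 / 2 : ℝ) := by
          rw [Finset.sum_const, Finset.sum_const, Finset.card_univ, nsmul_eq_mul, nsmul_eq_mul, hcard]; ring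
      _ ≤ _ := Finset.sum_le_sum fun x _ => Finset.sum_le_sum fun y _ => hpair x y
  rw [inv_mul_eq_div, le_div_iff₀ (by positivity)]
  exact hsum

end Summit.HubbardSuperconductivity.HubbardSuperconductivity.Theorems

end
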